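import Literature.NumberTheory.GelbartRogawski1991.UnitaryDualPairThetaKernelCM
import Literature.NumberTheory.GelbartRogawski1991.LocalUnitarySplittingDatum
import Literature.NumberTheory.Weil1964.DoublingDiagonalPolarisation
import Literature.NumberTheory.Weil1964.AdelicMetaplecticRationalLift
import Literature.NumberTheory.Weil1964.AdelicMetaplecticScalarTwist
import Literature.NumberTheory.Weil1964.AdelicMetaplecticFinRep
import Literature.NumberTheory.Automorphic.UnitaryGroupDirectSum
import Literature.NumberTheory.Automorphic.UnitaryGroupRestrictedProduct
import Literature.NumberTheory.Automorphic.UnitaryGroupArchimedean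
import Literature.NumberTheory.Automorphic.UnitaryGroupAdelicProduct
import Literature.NumberTheory.Automorphic.UnitaryGroupPlaceInclusion
import Literature.NumberTheory.Automorphic.IdeleClassGroup
import Literature.NumberTheory.Automorphic.IdeleClassGroupProofs
import Literature.RepresentationTheory.HarrisKudlaSweet1996.GlobalSplittingCharacters
import HarnessLib

-- buildfix G11b-3 recipe (LEDGER B13-1/B13-3): elaborate sequentially so the trailing `attribute [implicit_reducible]`
-- block (reducibilityCoreExt is keyed to the async environment branch) is in force at `.olean` export.
set_option Elab.async false

/-!
# [GelbartRogawski1991, Prop. 3.1.1] by DOUBLING — the global data of the construction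

Gelbart–Rogawski, *L-functions and Fourier–Jacobi coefficients for the unitary group U(3)*, Invent. Math. 105
(1991), §3.1 Prop. 3.1.1 p. 455 L1–2: for a unitary group `G = U(𝕍)` over a CM∕totally real pair `L ∕ L⁺` the
metaplectic cover of `Sp(Res_{L/L⁺} 𝕍)(𝔸)` splits over `G(𝔸)`, continuously, compatibly with Weil's rational
section.  This file and its siblings give a KERNEL CONSTRUCTION of that splitting for the datum of record
`cmSplittingDatum L e dV … dW …` (`𝕍 = V ⊗_L W` with diagonal Gram matrices, `UnitaryDualPairThetaKernelCM`), whose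
end theorem has literally the body of the abstract record `SplittingDatum.CompatibleSplitting`.  The route is
the DOUBLING METHOD [Kudla1994, §§1–3], [HarrisKudlaSweet1996, §1 (1.11)–(1.16), Cor. A.3] (Gelbart–Rogawski's own
proof, pp. 455–457, goes through Kazhdan's splitting over `SU` instead):

* `𝔻 := 𝕍 ⊕ (−𝕍)` (hermitian Gram `J ⊕ (−J)`), `H := U(𝔻)` — quasi-split, with SIEGEL PARABOLIC `P_Δ` = the
  stabiliser of the diagonal `Δ = {(x, x)}`; `H(k)` is the normal closure of `P_Δ(k)` over every field `k ⊇ L⁺`;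
* `𝕎^𝔻 := Res 𝔻 = 𝕎 ⊕ 𝕎⁻` with rational Gram `T^𝔻 = T ⊕ (−T)`; the tree's rational symplectic element
  `δ = deltaDiag` (`DoublingDiagonalPolarisation`) carries `Res Δ` onto the standard Lagrangian `𝕐`, so
  `δ ι(P_Δ) δ⁻¹ ⊆ P_𝕐`, whose implementers in the Schrödinger model are of EVALUATION FORM and hence pinned by their
  value-at-the-origin scalar;
* THE WEIL REPRESENTATION OF THE DOUBLED GROUP with Hecke character `χ` (`χ|_{𝕀_{L⁺}} = ε_{L/L⁺}`): a continuous
  homomorphism `sD : H(𝔸) →* Mp(𝕎^𝔻)ᶜᵒⁿᵗ` over `ι^𝔻` whose value-at-0 scalar on `p ∈ P_Δ(𝔸)` is PRESCRIBED to be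
  `χ(det_Δ p) |det_Δ p|_{𝔸_L}^{1/2}` ([HarrisKudlaSweet1996, §1 (1.15)]: `ω(m(a))φ(x) = χ(det a)|det a|^{m/2} φ(xa)`,
  `m = 1`) — the interface Prop `IsDoubledWeilRep χ sD` of §3, split into a finite half `IsFinHalf` and an
  archimedean half `IsArchHalf` (§4) which are assembled in `DoubledWeilRepresentationAssembly`;
* rational clause (`DoubledWeilRepresentationRationalSchur`, `…RationalParabolic`): on `P_Δ(L⁺)` the prescription
  gives `sD = r_F^𝔻` (`χ|_{L^×} = 1`, product formula), and two homomorphisms over the same `ι^𝔻` differ by a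
  central character, trivial on `P_Δ(L⁺)` hence on its normal closure `H(L⁺)` — NO product formula for Weil indices
  or cocycles is needed;
* undoubling (`DoubledWeilRepresentationUndoubling`): restrict to `U(𝕍) × 1 ⊂ H`, strip `⊗ 1`, and use Θ-rigidity
  on rational points.

Contents of THIS file (definitions with bodies and elementary theorems only; nothing is asserted):
§0 the Gram matrices `T`, `T^𝔻`, `T^𝔻 ⊗ 1`, `J^𝔻` and their units∕symmetry; §1 `H(𝔸)`, the Siegel predicate
`IsSiegelDelta`, `det_Δ`, `H(L⁺)`, `U(𝕍) × 1 ↪ H` (`inlG`); §2 `Mp(𝕎^𝔻)ᶜᵒⁿᵗ`, `π`, `ι^𝔻`, `r_F^𝔻`, `δ`; §3 the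
prescription (`chiDet`, `modDelta`, `opD`) and `IsDoubledWeilRep`; §3bis its local form `ParabolicNormalisedAt v`
(place inclusion `locToAdelic v`, `δ` read at `v`); §4 the halves `IsFinHalf`, `IsArchHalf` and the per-place
package `FinLocalFamily` (the `LocalSplittingDatum` of `LocalUnitarySplittingDatum` instantiated at the doubled
data); §5 joint injectivity of `(π, ω)` on `Mp(𝕎^𝔻)ᶜᵒⁿᵗ` and commutation of archimedean with finite operators.

Design: every `def` has a body over existing tree declarations; the Gram matrices are plain `def`s (NOT `abbrev`:
reducible unfolding of `reindex ∘ fromBlocks ∘ gram ∘ map` inside `Sp(𝔸)`∕`Mp(𝔸)` types makes `isDefEq` time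
out); algebra is proved over abstract groups and instantiated in one term where the concrete types are heavy.
-/

set_option autoImplicit false

noncomputable section

open scoped Classical
open scoped Matrix Kronecker TensorProduct
open NumberField IsDedekindDomain
open Literature.RepresentationTheory.HeisenbergGroup
open Literature.NumberTheory.Automorphic
open Literature.NumberTheory.Weil1964
open Literature.RepresentationTheory.HarrisKudlaSweet1996
open Literature.NumberTheory.GaloisRepresentations

namespace Literature.NumberTheory.GelbartRogawski1991.GRConstruction

open UnitaryDualPair

variable (L : Type) [Field L] [NumberField L] [IsCMField L]

/-- `L⁺`, the maximal real subfield of the CM field `L` (GR91's `F`; `E := L`).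
[cite: GelbartRogawski1991, §1.1 p. 449 L26] -/
abbrev Fp : Type := ↥(maximalRealSubfield L)

variable {N M n : ℕ} (e : Fin N × Fin M ≃ Fin n)
  (dV : Fin N → L) (hdV : ∀ i, IsCMField.complexConj L (dV i) = dV i) (hdV0 : ∀ i, dV i ≠ 0)
  (dW : Fin M → L) (hdW : ∀ i, IsCMField.complexConj L (dW i) = dW i) (hdW0 : ∀ i, dW i ≠ 0)

/-! ## §0 The data of record, abbreviated; the doubled data at index `Fin (n + n)` -/

/-- `T ∈ M_n(L⁺)`: the RATIONAL Gram matrix of `𝕎 = Res(V ⊗ W)` (`reindex e e (realDiag dV ⊗ realDiag dW)`; the datum's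
adelic Gram `adelicGram` is `T ⊗ 1`, `adelicGram_eq_map`).
[cite: GelbartRogawski1991, §3.1 Prop. 3.1.1 p. 455 L1–2] -/
def gramR : Matrix (Fin n) (Fin n) (Fp L) := gram (Fp L) e (realDiagonal L dV hdV) (realDiagonal L dW hdW)

/-- the re-enumeration `Fin n ⊕ Fin n ≃ Fin (n + n)` used throughout for the doubled space (so that the unitary-side
factorisation API `UnitaryGroup.adelic ∕ finAdelic ∕ localPi ∕ finAdelicEquiv ∕ localPiToSymplectic`, typed over `Fin N`,
applies with `N := n + n`). [cite: GelbartRogawski1991, §3.1 Prop. 3.1.1 p. 455 L1–2] -/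
abbrev e₂ : Fin n ⊕ Fin n ≃ Fin (n + n) := finSumFinEquiv

/-- **`T^𝔻 = T ⊕ (−T) ∈ M_{n+n}(L⁺)`**: the rational Gram matrix of the DOUBLED symplectic space `𝕎^𝔻 = 𝕎 ⊕ 𝕎⁻`
(tree convention `fromBlocks T 0 0 (−T)` of `DoublingDiagonalPolarisation`, re-enumerated by `e₂`).
[cite: GelbartRogawski1991, §3.1 Prop. 3.1.1 p. 455 L1–2] -/
def gramD : Matrix (Fin (n + n)) (Fin (n + n)) (Fp L) :=
  Matrix.reindex (e₂ (n := n)) (e₂ (n := n)) (Matrix.fromBlocks (gramR L e dV hdV dW hdW) 0 0 (-gramR L e dV hdV dW hdW))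

/-- `T^𝔻 ⊗ 1 ∈ M_{n+n}(𝔸_{L⁺})`. [cite: GelbartRogawski1991, §3.1 Prop. 3.1.1 p. 455 L1–2] -/
def gramDA : Matrix (Fin (n + n)) (Fin (n + n)) (AdeleRing (𝓞 (Fp L)) (Fp L)) :=
  (gramD L e dV hdV dW hdW).map (algebraMap (Fp L) (AdeleRing (𝓞 (Fp L)) (Fp L)))

/-- **`J^𝔻 := T^𝔻 ⊗_{L⁺} L ∈ M_{n+n}(L)`**, the hermitian Gram matrix of the doubled space `𝔻 = 𝕍 ⊕ (−𝕍)`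
(`= reindex e₂ e₂ (J ⊕ (−J))`, `J = reindex e e (diag dV ⊗ diag dW)`, by `realDiagonal_map`).
[cite: GelbartRogawski1991, §3.1 Prop. 3.1.1 p. 455 L1–2] -/
def hermD : Matrix (Fin (n + n)) (Fin (n + n)) L := (gramD L e dV hdV dW hdW).map (algebraMap (Fp L) L)

/-- `T^𝔻` is symmetric (blocks of the symmetric `T`;
`isUnit_det_fromBlocks_neg`, `isUnit_det_gram`). [cite: GelbartRogawski1991, §3.1 Prop. 3.1.1 p. 455 L1–2] -/
theorem gramD_isSymm : (gramD L e dV hdV dW hdW).IsSymm := by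
  have hT : (gramR L e dV hdV dW hdW).IsSymm := by
    show (Matrix.reindex e e _).IsSymm
    exact (UnitaryGroup.isSymm_kronecker (realDiagonal_isSymm L dV hdV) (realDiagonal_isSymm L dW hdW)).submatrix _
  show (Matrix.reindex _ _ (Matrix.fromBlocks _ _ _ _)).IsSymm
  exact (Matrix.isSymm_fromBlocks_iff.2 ⟨hT, by simp, by simp, hT.neg⟩).submatrix _

include hdV0 hdW0 in
/-- `det T^𝔻` is a unit. [cite: GelbartRogawski1991, §3.1 Prop. 3.1.1 p. 455 L1–2] -/
theorem isUnit_det_gramD : IsUnit (gramD L e dV hdV dW hdW).det := by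
  rw [gramD, Matrix.det_reindex_self]
  exact isUnit_det_fromBlocks_neg _
    (isUnit_det_gram (Fp L) e (isUnit_det_realDiagonal L dV hdV hdV0) (isUnit_det_realDiagonal L dW hdW hdW0))

include hdV0 hdW0 in
/-- `det (T^𝔻 ⊗ 1)` is a unit. [cite: GelbartRogawski1991, §3.1 Prop. 3.1.1 p. 455 L1–2] -/
theorem isUnit_det_gramDA : IsUnit (gramDA L e dV hdV dW hdW).det := by
  rw [gramDA, ← RingHom.mapMatrix_apply, ← RingHom.map_det]
  exact (isUnit_det_gramD L e dV hdV hdV0 dW hdW hdW0).map _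

/-- the datum of record (display abbreviation). [cite: GelbartRogawski1991, §3.1 Prop. 3.1.1 p. 455 L1–2] -/
abbrev D := cmSplittingDatum L e dV hdV hdV0 dW hdW hdW0

/-! ## §1 The doubled unitary group `H(𝔸) = U(𝔻)(𝔸_{L⁺})`, its Siegel parabolic `P_Δ`, rational points, `U(𝕍) × 1 ↪ H` -/

/-- **`H(𝔸) = U(J^𝔻)(𝔸_{L⁺}) ≤ GL_{n+n}(𝔸_L)`** — the tree's `UnitaryGroup.adelic` (so that `UnitaryGroup.finAdelicEquiv`:
`H(𝔸_f) ≃ₜ* Π'_v H(L⁺_v)` and `localPiToSymplectic` apply verbatim with `N := n + n`, `J := J^𝔻`).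
[cite: GelbartRogawski1991, §3.1 Prop. 3.1.1 p. 455 L1–2] -/
abbrev HA : Subgroup (GL (Fin (n + n)) (AdeleRing (𝓞 L) L)) :=
  UnitaryGroup.adelic (Fp L) L (IsCMField.complexConj L) (n + n) (hermD L e dV hdV dW hdW)

/-- the matrix of `h ∈ H(𝔸)` in the block enumeration `Fin n ⊕ Fin n` (`𝔻 = 𝕍 ⊕ 𝕍`).
[cite: GelbartRogawski1991, §3.1 Prop. 3.1.1 p. 455 L1–2] -/
abbrev blk (h : HA L e dV hdV dW hdW) : Matrix (Fin n ⊕ Fin n) (Fin n ⊕ Fin n) (AdeleRing (𝓞 L) L) :=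
  Matrix.reindex (e₂ (n := n)).symm (e₂ (n := n)).symm
    ((h : GL (Fin (n + n)) (AdeleRing (𝓞 L) L)) : Matrix (Fin (n + n)) (Fin (n + n)) (AdeleRing (𝓞 L) L))

/-- **`h ∈ P_Δ(𝔸)`**: `h` stabilises the diagonal `Δ = {(x, x)}` of `𝔻 = 𝕍 ⊕ 𝕍`, i.e. `h (x, x) = (y, y)`:
the two block-row sums agree, `h₁₁ + h₁₂ = h₂₁ + h₂₂`. [cite: GelbartRogawski1991, §3.1 Prop. 3.1.1 p. 455 L1–2] -/
def IsSiegelDelta (h : HA L e dV hdV dW hdW) : Prop :=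
  (blk L e dV hdV dW hdW h).toBlocks₁₁ + (blk L e dV hdV dW hdW h).toBlocks₁₂ =
    (blk L e dV hdV dW hdW h).toBlocks₂₁ + (blk L e dV hdV dW hdW h).toBlocks₂₂

/-- the action of `h ∈ P_Δ(𝔸)` on `Δ ≅ 𝔸_Lⁿ`: the matrix `h₁₁ + h₁₂`.
[cite: GelbartRogawski1991, §3.1 Prop. 3.1.1 p. 455 L1–2] -/
def deltaBlock (h : HA L e dV hdV dW hdW) : Matrix (Fin n) (Fin n) (AdeleRing (𝓞 L) L) :=
  (blk L e dV hdV dW hdW h).toBlocks₁₁ + (blk L e dV hdV dW hdW h).toBlocks₁₂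

/-- `det_Δ h := det (h|_Δ) ∈ 𝔸_L` (a unit for `h ∈ P_Δ(𝔸)`; Kudla's `x(p)` on the Siegel parabolic of the doubled group).
[cite: GelbartRogawski1991, §3.1 Prop. 3.1.1 p. 455 L1–2] -/
def detDelta (h : HA L e dV hdV dW hdW) : AdeleRing (𝓞 L) L := (deltaBlock L e dV hdV dW hdW h).det

/-- the rational points `H(L⁺) ≤ H(𝔸)` (range of the tree's `UnitaryGroup.toAdelic`).
[cite: GelbartRogawski1991, §3.1 Prop. 3.1.1 p. 455 L1–2] -/
abbrev ratH : Subgroup (HA L e dV hdV dW hdW) :=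
  (UnitaryGroup.toAdelic (Fp L) L (IsCMField.complexConj L) (n + n) (hermD L e dV hdV dW hdW)).range

/-- the adelic form of the datum's pair: `(diag dV ⊗ 1) ⊗ₖ (diag dW ⊗ 1)` on `Fin N × Fin M`.
[cite: GelbartRogawski1991, §3.1 Prop. 3.1.1 p. 455 L1–2] -/
abbrev pairFormA : Matrix (Fin N × Fin M) (Fin N × Fin M) (AdeleRing (𝓞 L) L) :=
  UnitaryGroup.adelicForm L N (Matrix.diagonal dV) ⊗ₖ UnitaryGroup.adelicForm L M (Matrix.diagonal dW)

/-- the doubled adelic form is the re-enumerated block form `J_𝔸 ⊕ (−J_𝔸)`.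
[cite: GelbartRogawski1991, §3.1 Prop. 3.1.1 p. 455 L1–2] -/
theorem adelicForm_hermD_eq :
    UnitaryGroup.adelicForm L (n + n) (hermD L e dV hdV dW hdW) =
      Matrix.reindex (e₂ (n := n)) (e₂ (n := n))
        (Matrix.fromBlocks (Matrix.reindex e e (pairFormA L dV dW)) 0 0 (-Matrix.reindex e e (pairFormA L dV dW))) := by
  have hP : pairFormA L dV dW =
      ((realDiagonal L dV hdV ⊗ₖ realDiagonal L dW hdW).map (algebraMap (Fp L) L)).map (algebraMap L (AdeleRing (𝓞 L) L)) := by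
    rw [← UnitaryGroup.kronecker_map_map, realDiagonal_map, realDiagonal_map]
    exact UnitaryGroup.kronecker_map_map _ _ _
  set f : Fp L → AdeleRing (𝓞 L) L := ⇑(algebraMap L (AdeleRing (𝓞 L) L)) ∘ ⇑(algebraMap (Fp L) L) with hf
  have hf0 : f 0 = 0 := by simp [hf]
  have hfn : ∀ a, f (-a) = -f a := fun a => by simp [hf]
  unfold UnitaryGroup.adelicForm hermD gramD gramR
  rw [hP, Matrix.map_map, Matrix.map_map, ← hf]
  simp only [Matrix.reindex_apply, ← Matrix.submatrix_map, Matrix.fromBlocks_map, Matrix.map_zero f hf0,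
    Matrix.map_neg f hfn]

/-- **`U(𝕍)(𝔸) × 1 ↪ H(𝔸)`**, `g ↦ g ⊕ 1` on `G₁(𝔸) = adelicPair … (diag dV) (diag dW)` (index `Fin N × Fin M`,
re-enumerated by `e`, then placed as the first diagonal block and re-enumerated by `e₂`) — a composite of the tree's
`UnitaryGroup.reindexU` and `UnitaryGroup.blockDiag`, cast along `adelicForm_hermD_eq`.
[cite: GelbartRogawski1991, §3.1 Prop. 3.1.1 p. 455 L1–2] -/
def inlG : UnitaryGroup.adelicPair (Fp L) L (IsCMField.complexConj L) N M (Matrix.diagonal dV) (Matrix.diagonal dW) →*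
    HA L e dV hdV dW hdW :=
  (Subgroup.inclusion (le_of_eq (congrArg (unitaryGroupOfForm (UnitaryGroup.conjAdele (Fp L) L (IsCMField.complexConj L)))
      (adelicForm_hermD_eq L e dV hdV dW hdW).symm))).comp <|
    (UnitaryGroup.reindexU _ (e₂ (n := n)) _).comp <|
      (UnitaryGroup.blockDiag _ _ _).comp <|
        (MonoidHom.prod ((UnitaryGroup.reindexU _ e _)) 1)

/-! ## §2 The doubled symplectic side: `Sp(𝕎^𝔻)`, `Mp(𝕎^𝔻)ᶜᵒⁿᵗ`, `ι^𝔻`, `r_F^𝔻`, `δ` -/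

/-- `Mp(𝕎^𝔻)ᶜᵒⁿᵗ` — the metaplectic group of record of the DOUBLED space (same construction as the datum's `Mp`).
[cite: GelbartRogawski1991, §3.1 Prop. 3.1.1 p. 455 L1–2] -/
abbrev MpD := adelicMpCont (Fp L) (Fin (n + n)) (gramDA L e dV hdV dW hdW)

/-- `π` on `Mp(𝕎^𝔻)ᶜᵒⁿᵗ`. [cite: GelbartRogawski1991, §3.1 Prop. 3.1.1 p. 455 L1–2] -/
abbrev projD : MpD L e dV hdV dW hdW →* symplecticGroup (polar (adelicForm (Fp L) (Fin (n + n)) (gramDA L e dV hdV dW hdW))) :=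
  adelicMpCont.proj (Fp L) (Fin (n + n)) (gramDA L e dV hdV dW hdW)

/-- **`ι^𝔻 : H(𝔸) →* Sp(𝕎^𝔻_𝔸)`**, restriction of scalars `L → L⁺` for the doubled hermitian space — the tree's
`UnitaryGroup.adelicToSymplectic` at `N := n + n`, `T := T^𝔻`, `J := J^𝔻 = T^𝔻 ⊗ L` (`hJ := rfl`).
[cite: GelbartRogawski1991, §3.1 Prop. 3.1.1 p. 455 L1–2] -/
def toSpD : HA L e dV hdV dW hdW →* symplecticGroup (polar (adelicForm (Fp L) (Fin (n + n)) (gramDA L e dV hdV dW hdW))) :=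
  UnitaryGroup.adelicToSymplectic (Fp L) L (IsCMField.complexConj L) (n + n) (complexConj_imagUnit L) (imagUnit_ne_zero L)
    (imagUnit_mul_self L) (gramD_isSymm L e dV hdV dW hdW) rfl

/-- **`r_F^𝔻 : Sp_{2(n+n)}(L⁺) →* Mp(𝕎^𝔻)ᶜᵒⁿᵗ`** — Weil's Θ-rigid rational section of the doubled space.
[cite: GelbartRogawski1991, §3.1 Prop. 3.1.1 p. 455 L1–2] -/
abbrev rFD : Matrix.symplecticGroup (Fin (n + n)) (Fp L) →* MpD L e dV hdV dW hdW :=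
  ratThetaLiftCont (Fp L) (gramDA L e dV hdV dW hdW) (isUnit_det_gramDA L e dV hdV hdV0 dW hdW hdW0)

omit [NumberField L] [IsCMField L] in
/-- re-enumerating Mathlib's symplectic matrices along `e₂ ⊕ e₂` (`J_l` is block-natural).
[cite: GelbartRogawski1991, §3.1 Prop. 3.1.1 p. 455 L1–2] -/
theorem reindex_deltaDiag_mem_symplecticGroup :
    Matrix.reindex ((e₂ (n := n)).sumCongr (e₂ (n := n))) ((e₂ (n := n)).sumCongr (e₂ (n := n)))
        (deltaDiagMatrix (Fp L) (Fin n)) ∈ Matrix.symplecticGroup (Fin (n + n)) (Fp L) := by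
  have h := deltaDiagMatrix_mem (Fp L) (Fin n)
  rw [SymplecticGroup.mem_iff] at h ⊢
  have hJ : Matrix.J (Fin (n + n)) (Fp L) =
      Matrix.reindex ((e₂ (n := n)).sumCongr (e₂ (n := n))) ((e₂ (n := n)).sumCongr (e₂ (n := n)))
        (Matrix.J (Fin n ⊕ Fin n) (Fp L)) := by
    ext i j
    rcases i with i | i <;> rcases j with j | j <;>
      simp [Matrix.J, Matrix.fromBlocks, Matrix.one_apply, (e₂ (n := n)).symm.injective.eq_iff]
  rw [hJ, Matrix.reindex_apply, Matrix.reindex_apply, Matrix.transpose_submatrix, Matrix.submatrix_mul_equiv,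
    Matrix.submatrix_mul_equiv, h]

/-- **`δ ∈ Sp(𝕎^𝔻)(L⁺)`**: the tree's RATIONAL symplectic element `deltaDiag` carrying `Res Δ` onto the standard
Lagrangian `𝕐` (`transportSp_deltaDiag_diag`), re-enumerated by `e₂`.
[cite: GelbartRogawski1991, §3.1 Prop. 3.1.1 p. 455 L1–2] -/
def deltaD : Matrix.symplecticGroup (Fin (n + n)) (Fp L) :=
  ⟨_, reindex_deltaDiag_mem_symplecticGroup L⟩

/-- `r_F^𝔻(δ) ∈ Mp(𝕎^𝔻)ᶜᵒⁿᵗ`. [cite: GelbartRogawski1991, §3.1 Prop. 3.1.1 p. 455 L1–2] -/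
abbrev rDelta : MpD L e dV hdV dW hdW := rFD L e dV hdV hdV0 dW hdW hdW0 (deltaD L)

/-! ## §3 The PRESCRIPTION on the Siegel parabolic and the interface Prop `IsDoubledWeilRep χ sD`

No operator data is introduced: an implementer `M` of an element of the standard Siegel parabolic `P_𝕐` (stabiliser of
the Lagrangian `𝕐 = {0} × 𝔸^{n⊕n}`; functions live on `𝕏`) is of "evaluation form" `(M Φ)(x) = c · ψ(q(x)) · Φ(A x)`, so
it is PINNED by the one scalar `(M Φ)(0) ∕ Φ(0) = c`.  For `p ∈ P_Δ(𝔸)`, `δ ι^𝔻(p) δ⁻¹ ∈ P_𝕐(𝔸)`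
(`transportSp_deltaDiag_diag`), and the Weil representation of the doubled group with character `χ` has there
`c = χ(det_Δ p) · |det_Δ p|_{𝔸_L}^{1/2}` ([HarrisKudlaSweet1996, §1: `ω(m(a))φ(x) = χ(det a)|det a|^{m/2} φ(xa)`
with `m = dim` of the partner line `= 1`]; the modulus is forced by unitarity ∕ extendability to `H(𝔸)`, the
character `χ` is the CHOICE that makes the extension exist, `χ|_{𝕀_{L⁺}} = ε_{L/L⁺}`). -/

/-- `χ(det_Δ p)` for a Hecke character `χ` of `L` (`HeckeCharacter L` = continuous characters of `𝕀_L = 𝔸_L^×` trivial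
on `L^×`), read at the idele `det_Δ p` (a unit for `p ∈ P_Δ(𝔸)`; total definition, value `1` off units).
[cite: GelbartRogawski1991, §3.1 Prop. 3.1.1 p. 455 L1–2] -/
def chiDet (χ : HeckeCharacter L) (p : HA L e dV hdV dW hdW) : ℂˣ :=
  if hu : IsUnit (detDelta L e dV hdV dW hdW p) then χ hu.unit else 1

/-- `|det_Δ p|_{𝔸_L}^{1/2}` (idelic norm; `1` off units). [cite: GelbartRogawski1991, §3.1 Prop. 3.1.1 p. 455 L1–2] -/
def modDelta (p : HA L e dV hdV dW hdW) : ℝ :=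
  if hu : IsUnit (detDelta L e dV hdV dW hdW p) then Real.sqrt (ideleNorm hu.unit) else 1

/-- the Weil operator of `q ∈ Mp(𝕎^𝔻)ᶜᵒⁿᵗ` on `Φ ∈ 𝒮(𝔸_{L⁺}^{n⊕n})`, as a function.
[cite: GelbartRogawski1991, §3.1 Prop. 3.1.1 p. 455 L1–2] -/
abbrev opD (q : MpD L e dV hdV dW hdW) (Φ : piSchwartzBruhat (Fp L) (Fin (n + n))) :
    (Fin (n + n) → AdeleRing (𝓞 (Fp L)) (Fp L)) → ℂ :=
  ((adelicMpCont.omega (Fp L) (Fin (n + n)) (gramDA L e dV hdV dW hdW) q Φ : piSchwartzBruhat (Fp L) (Fin (n + n))) :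
    (Fin (n + n) → AdeleRing (𝓞 (Fp L)) (Fp L)) → ℂ)

/-- **THE INTERFACE PROP.**  `sD` is "the Weil representation of the doubled group `H = U(𝕍 ⊕ −𝕍)` with
character `χ`": a homomorphism `H(𝔸) →* Mp(𝕎^𝔻)ᶜᵒⁿᵗ`, CONTINUOUS, over `ι^𝔻`, with the PRESCRIBED NORMALISATION on
the Siegel parabolic `P_Δ(𝔸)`: the implementer `r_F^𝔻(δ) · sD(p) · r_F^𝔻(δ)⁻¹` of `δ ι^𝔻(p) δ⁻¹ ∈ P_𝕐(𝔸)` has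
value-at-the-origin scalar `χ(det_Δ p) |det_Δ p|_{𝔸_L}^{1/2}`.  Since `H(k)` is the normal closure of `P_Δ(k)`,
such an `sD` is UNIQUE (two candidates differ by a central character of `H(𝔸)` trivial on `P_Δ(𝔸)`), so the
existence statement is rigid; per place the same Prop (local field `k = L⁺_v`, local Schrödinger model) is the
finite (`IsFinHalf`, from `FinLocalFamily`) ∕ archimedean (`IsArchHalf`) input.
[cite: GelbartRogawski1991, §3.1 Prop. 3.1.1 p. 455 L1–2] -/
structure IsDoubledWeilRep (χ : HeckeCharacter L) (sD : HA L e dV hdV dW hdW →* MpD L e dV hdV dW hdW) : Prop where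
  /-- `sD` is continuous (weak topology of `Mp(𝕎^𝔻)ᶜᵒⁿᵗ`) -/
  continuous : Continuous sD
  /-- `π ∘ sD = ι^𝔻` -/
  proj_eq : ∀ h, projD L e dV hdV dW hdW (sD h) = toSpD L e dV hdV dW hdW h
  /-- the parabolic normalisation on `P_Δ(𝔸)` -/
  parabolic : ∀ (p : HA L e dV hdV dW hdW), IsSiegelDelta L e dV hdV dW hdW p → IsUnit (detDelta L e dV hdV dW hdW p) →
    ∀ Φ : piSchwartzBruhat (Fp L) (Fin (n + n)),
      opD L e dV hdV dW hdW (rDelta L e dV hdV hdV0 dW hdW hdW0 * sD p * (rDelta L e dV hdV hdV0 dW hdW hdW0)⁻¹) Φ 0 =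
        ((chiDet L e dV hdV dW hdW χ p : ℂˣ) : ℂ) * (modDelta L e dV hdV dW hdW p : ℂ) *
          (Φ : (Fin (n + n) → AdeleRing (𝓞 (Fp L)) (Fp L)) → ℂ) 0

/-! ## §3bis The LOCAL form of the parabolic normalisation (the field of the per-place package at the doubled data)

Stated WITHOUT local-component vocabulary: a local element `p ∈ H(L⁺_v)` is read in `H(𝔸)` through the place-`v`
inclusion `locToAdelic v` (Mathlib `RestrictedProduct.mulSingle` + tree `UnitaryGroup.finAdelicEquiv` + `finAdelicToAdelic`),
and the prescribed scalar is the GLOBAL `χ(det_Δ ·) |det_Δ ·|_{𝔸_L}^{1/2}` at that adelic element (all other components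
are `1`).  The local Weil data enter only through `ω_v` (= `(𝓓 v).localOmega`) and one implementer `M_δ` of the
rational `δ` read at `v` (= `(𝓓 v).r (deltaLoc v)`). -/

section Local

variable (v : HeightOneSpectrum (𝓞 (Fp L)))

/-- the place-`v` inclusion `H(L⁺_v) →* H(𝔸)`: `p ↦ (1, …, p, …, 1)` (finite part) with trivial archimedean part —
the TREE's named inclusion `UnitaryGroup.inclPlaceAdelic` (component API `evalPlace_inclPlace`,
`evalPlace_inclPlace_of_ne`, `exists_eq_mul_inclPlace`, `archPart_inclPlaceAdelic`, `finPart_inclPlaceAdelic`, …).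
[cite: GelbartRogawski1991, §3.1 Prop. 3.1.1 p. 455 L1–2] -/
def locToAdelic :
    UnitaryGroup.localPi L (IsCMField.complexConj L) (n + n) (hermD L e dV hdV dW hdW) v →* HA L e dV hdV dW hdW :=
  UnitaryGroup.inclPlaceAdelic (Fp L) L (IsCMField.complexConj L) (n + n) (hermD L e dV hdV dW hdW) v

/-- the local Gram matrix `T^𝔻 ⊗ L⁺_v`. [cite: GelbartRogawski1991, §3.1 Prop. 3.1.1 p. 455 L1–2] -/
abbrev gramDLoc : Matrix (Fin (n + n)) (Fin (n + n)) (v.adicCompletion (Fp L)) :=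
  (gramD L e dV hdV dW hdW).map (algebraMap (Fp L) (v.adicCompletion (Fp L)))

include hdV0 hdW0 in
/-- `det (T^𝔻 ⊗ L⁺_v)` is a unit. [cite: GelbartRogawski1991, §3.1 Prop. 3.1.1 p. 455 L1–2] -/
theorem isUnit_det_gramDLoc : IsUnit (gramDLoc L e dV hdV dW hdW v).det := by
  rw [gramDLoc, ← RingHom.mapMatrix_apply, ← RingHom.map_det]
  exact (isUnit_det_gramD L e dV hdV hdV0 dW hdW hdW0).map _

/-- **`δ` read at `v`**: the rational symplectic element `δ` in the local symplectic group `Sp(𝕎^𝔻_v)` (= the local package's `LocalSp`,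
the codomain of `UnitaryGroup.localPiToSymplectic v`). [cite: GelbartRogawski1991, §3.1 Prop. 3.1.1 p. 455 L1–2] -/
def deltaLoc : symplecticGroup (polar (Matrix.toLinearMap₂' (v.adicCompletion (Fp L)) (gramDLoc L e dV hdV dW hdW v))) :=
  SymplecticMatrix.transportSp (gramDLoc L e dV hdV dW hdW v) (isUnit_det_gramDLoc L e dV hdV hdV0 dW hdW hdW0 v)
    (SymplecticMatrix.mapHom (algebraMap (Fp L) (v.adicCompletion (Fp L))) (deltaD L))

/-- **`ParabolicNormalisedAt v χ ω_v M_δ`** — THE LOCAL PARABOLIC NORMALISATION at the finite place `v` (stated per place for `ω_v := (𝓓 v).localOmega`, `M_δ := (𝓓 v).r (deltaLoc v)` at the doubled datum, Lagrangian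
`ℓ := δ⁻¹(0 × Y)`; for Kudla's `β` it holds ON THE NOSE: `j(p) = 0`, `x(p) = det_Δ p` on `P_Δ`):
for `p ∈ P_Δ(L⁺_v)` (read adelically) and every `Φ ∈ 𝒮((L⁺_v)^{n+n})`,
`(M_δ (ω_v(p) (M_δ⁻¹ Φ)))(0) = χ(det_Δ p̂) · |det_Δ p̂|_{𝔸_L}^{1/2} · Φ(0)`, `p̂ = locToAdelic v p`.
[cite: GelbartRogawski1991, §3.1 Prop. 3.1.1 p. 455 L1–2] -/
def ParabolicNormalisedAt (χ : HeckeCharacter L)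
    (ω : Representation ℂ (UnitaryGroup.localPi L (IsCMField.complexConj L) (n + n) (hermD L e dV hdV dW hdW) v)
      (SchwartzBruhat (Fin (n + n) → v.adicCompletion (Fp L))))
    (Mδ : SchwartzBruhat (Fin (n + n) → v.adicCompletion (Fp L)) ≃ₗ[ℂ]
      SchwartzBruhat (Fin (n + n) → v.adicCompletion (Fp L))) : Prop :=
  ∀ p : UnitaryGroup.localPi L (IsCMField.complexConj L) (n + n) (hermD L e dV hdV dW hdW) v,
    IsSiegelDelta L e dV hdV dW hdW (locToAdelic L e dV hdV dW hdW v p) →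
    IsUnit (detDelta L e dV hdV dW hdW (locToAdelic L e dV hdV dW hdW v p)) →
    ∀ Φ : SchwartzBruhat (Fin (n + n) → v.adicCompletion (Fp L)),
      ((Mδ (ω p (Mδ.symm Φ)) : SchwartzBruhat (Fin (n + n) → v.adicCompletion (Fp L))) :
          (Fin (n + n) → v.adicCompletion (Fp L)) → ℂ) 0 =
        ((chiDet L e dV hdV dW hdW χ (locToAdelic L e dV hdV dW hdW v p) : ℂˣ) : ℂ) *
          (modDelta L e dV hdV dW hdW (locToAdelic L e dV hdV dW hdW v p) : ℂ) *
          ((Φ : SchwartzBruhat (Fin (n + n) → v.adicCompletion (Fp L))) : (Fin (n + n) → v.adicCompletion (Fp L)) → ℂ) 0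

end Local

/-! ## §4 The two adelic halves of the doubled Weil representation and the per-place package

Both halves are stated with the SAME adelic vocabulary (`H(𝔸)`, `ι^𝔻`, `P_Δ`, `χ(det_Δ ·)`, `|det_Δ ·|`), through the
tree's inclusions `UnitaryGroup.finAdelicToAdelic : H(𝔸_f) →* H(𝔸)` and `UnitaryGroup.archToAdelic : H(L⁺ ⊗ ℝ) →* H(𝔸)`;
an operator is FINITE if it is `1 ⊗ B`, ARCHIMEDEAN if it is `A ⊗ 1` on `𝒮(𝔸^{n+n}) = 𝓢 ⊗ 𝒮_f` (`adelicTensorEnd`). -/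

/-- the parabolic prescription for a partial splitting `s : G →* Mp(𝕎^𝔻)ᶜᵒⁿᵗ` along `j : G →* H(𝔸)`.
[cite: GelbartRogawski1991, §3.1 Prop. 3.1.1 p. 455 L1–2] -/
def ParabolicPrescribed {G : Type*} [Group G] (j : G →* HA L e dV hdV dW hdW) (χ : HeckeCharacter L)
    (s : G →* MpD L e dV hdV dW hdW) : Prop :=
  ∀ g : G, IsSiegelDelta L e dV hdV dW hdW (j g) → IsUnit (detDelta L e dV hdV dW hdW (j g)) →
    ∀ Φ : piSchwartzBruhat (Fp L) (Fin (n + n)),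
      opD L e dV hdV dW hdW (rDelta L e dV hdV hdV0 dW hdW hdW0 * s g * (rDelta L e dV hdV hdV0 dW hdW hdW0)⁻¹) Φ 0 =
        ((chiDet L e dV hdV dW hdW χ (j g) : ℂˣ) : ℂ) * (modDelta L e dV hdV dW hdW (j g) : ℂ) *
          (Φ : (Fin (n + n) → AdeleRing (𝓞 (Fp L)) (Fp L)) → ℂ) 0

/-- **the FINITE half** (assembled over the finite places by `finiteAdelePullback` from the family
`𝓓 v : LocalSplittingDatum … (n+n) … v μ_v ℓ_v hℓ_v` with `ParabolicNormalisedAt v χ (𝓓 v).localOmega ((𝓓 v).r (deltaLoc v))`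
and the unramified clause a.e.): `sf : H(𝔸_f) →* Mp(𝕎^𝔻)ᶜᵒⁿᵗ` over `ι^𝔻`, continuous (restricted-product topology), by FINITE
operators, parabolic-prescribed on `P_Δ(𝔸_f)`. [cite: GelbartRogawski1991, §3.1 Prop. 3.1.1 p. 455 L1–2] -/
structure IsFinHalf (χ : HeckeCharacter L)
    (sf : UnitaryGroup.finAdelic (Fp L) L (IsCMField.complexConj L) (n + n) (hermD L e dV hdV dW hdW) →*
      MpD L e dV hdV dW hdW) : Prop where
  /-- continuity -/
  continuous : Continuous sf
  /-- `π ∘ s = ι^𝔻 ∘ j` -/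
  proj_eq : ∀ g, projD L e dV hdV dW hdW (sf g) = toSpD L e dV hdV dW hdW
    (UnitaryGroup.finAdelicToAdelic (Fp L) L (IsCMField.complexConj L) (n + n) (hermD L e dV hdV dW hdW) g)
  /-- the operators are finite: `1 ⊗ B` -/
  isFinite : ∀ g, ∃ B : FinSB (Fp L) (Fin (n + n)) →ₗ[ℂ] FinSB (Fp L) (Fin (n + n)),
    (adelicMpCont.omega (Fp L) (Fin (n + n)) (gramDA L e dV hdV dW hdW) (sf g) :
        piSchwartzBruhat (Fp L) (Fin (n + n)) →ₗ[ℂ] piSchwartzBruhat (Fp L) (Fin (n + n))) =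
      adelicTensorEnd LinearMap.id B
  /-- the parabolic prescription on `P_Δ(𝔸_f)` -/
  parabolic : ParabolicPrescribed L e dV hdV hdV0 dW hdW hdW0
    (UnitaryGroup.finAdelicToAdelic (Fp L) L (IsCMField.complexConj L) (n + n) (hermD L e dV hdV dW hdW)) χ sf

/-- **the ARCHIMEDEAN half**: `s∞ : H(L⁺ ⊗ ℝ) →* Mp(𝕎^𝔻)ᶜᵒⁿᵗ` over `ι^𝔻`, continuous, by ARCHIMEDEAN operators
(`A ⊗ 1` with `A` a topological automorphism of `𝓢`; cf. `AdelicMetaplecticArchRep.archRepMp`, `IsArchWeilDatum`),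
parabolic-prescribed on `P_Δ(L⁺ ⊗ ℝ)` (existence only; no closed form off `P_Δ`).
[cite: GelbartRogawski1991, §3.1 Prop. 3.1.1 p. 455 L1–2] -/
structure IsArchHalf (χ : HeckeCharacter L)
    (sa : UnitaryGroup.arch (Fp L) L (IsCMField.complexConj L) (n + n) (hermD L e dV hdV dW hdW) →*
      MpD L e dV hdV dW hdW) : Prop where
  /-- continuity -/
  continuous : Continuous sa
  /-- `π ∘ s = ι^𝔻 ∘ j` -/
  proj_eq : ∀ g, projD L e dV hdV dW hdW (sa g) = toSpD L e dV hdV dW hdW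
    (UnitaryGroup.archToAdelic (Fp L) L (IsCMField.complexConj L) (n + n) (hermD L e dV hdV dW hdW) g)
  /-- the operators are archimedean: `A ⊗ 1` -/
  isArch : ∀ g, ∃ A : SchwartzMap (Fin (n + n) → mixedEmbedding.mixedSpace (Fp L)) ℂ →L[ℂ]
      SchwartzMap (Fin (n + n) → mixedEmbedding.mixedSpace (Fp L)) ℂ,
    (adelicMpCont.omega (Fp L) (Fin (n + n)) (gramDA L e dV hdV dW hdW) (sa g) :
        piSchwartzBruhat (Fp L) (Fin (n + n)) →ₗ[ℂ] piSchwartzBruhat (Fp L) (Fin (n + n))) =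
      adelicTensorEnd (A : SchwartzMap (Fin (n + n) → mixedEmbedding.mixedSpace (Fp L)) ℂ →ₗ[ℂ]
        SchwartzMap (Fin (n + n) → mixedEmbedding.mixedSpace (Fp L)) ℂ) LinearMap.id
  /-- the parabolic prescription on `P_Δ(L⁺ ⊗ ℝ)` -/
  parabolic : ParabolicPrescribed L e dV hdV hdV0 dW hdW hdW0
    (UnitaryGroup.archToAdelic (Fp L) L (IsCMField.complexConj L) (n + n) (hermD L e dV hdV dW hdW)) χ sa


/-! #### The per-place package: the tree's `LocalSplittingDatum` at the DOUBLED data -/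

section PerPlace

open Literature.NumberTheory.GelbartRogawski1991.UnitaryDualPair.LocalSplitting MeasureTheory

/-- Haar data at a finite place (the tree's local files take `[MeasurableSpace] [BorelSpace] (μ) [IsAddHaarMeasure]` as
parameters; a family over all `v` is carried by this bundle).
[cite: GelbartRogawski1991, §3.1 Prop. 3.1.1 p. 455 L1–2] -/
structure PlaceMeasure (v : HeightOneSpectrum (𝓞 (Fp L))) where
  /-- the σ-algebra (the Borel one) -/
  mS : MeasurableSpace (v.adicCompletion (Fp L))
  /-- it is the Borel σ-algebra -/
  isBorel : (letI := mS; BorelSpace (v.adicCompletion (Fp L)))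
  /-- a Haar measure -/
  μ : (letI := mS; MeasureTheory.Measure (v.adicCompletion (Fp L)))
  /-- `μ` is an additive Haar measure -/
  isHaar : (letI := mS; μ.IsAddHaarMeasure)

include hdV0 hdW0 in
/-- **the tree's `LocalSplittingDatum` (`LocalUnitarySplittingDatum`) INSTANTIATED at the doubled data**
`(N, T, J) := (n+n, T^𝔻, J^𝔻)` (`hJ := rfl`), at the place `v`, Haar data `𝔪`, Lagrangian `ℓ` (`hℓ : ℓ^⊥ = ℓ`; the intended one is
`δ⁻¹(0 × Y)`, for which Kudla's `β` splits the Leray cocycle on the nose).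
[cite: GelbartRogawski1991, §3.1 Prop. 3.1.1 p. 455 L1–2] -/
def LocalDatumAt (v : HeightOneSpectrum (𝓞 (Fp L))) (𝔪 : PlaceMeasure L v)
    (ℓ : Submodule (v.adicCompletion (Fp L)) ((Fin (n + n) → v.adicCompletion (Fp L)) × (Fin (n + n) → v.adicCompletion (Fp L))))
    (hℓ : LinearMap.BilinForm.orthogonal (alt (polar (localPairing (Fp L) (n + n) (gramD L e dV hdV dW hdW) v))) ℓ = ℓ) :
    Type := by
  letI := 𝔪.mS; haveI := 𝔪.isBorel; haveI := 𝔪.isHaar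
  exact LocalSplittingDatum (Fp L) L (IsCMField.complexConj L) (n + n) (complexConj_imagUnit L) (imagUnit_ne_zero L)
    (imagUnit_mul_self L) (gramD L e dV hdV dW hdW) (gramD_isSymm L e dV hdV dW hdW)
    (isUnit_det_gramD L e dV hdV hdV0 dW hdW hdW0) (J := hermD L e dV hdV dW hdW) rfl v 𝔪.μ ℓ hℓ

/-- the local Weil representation `ω_v` of the datum (`localOmega`, instances unbundled from `𝔪`).
[cite: GelbartRogawski1991, §3.1 Prop. 3.1.1 p. 455 L1–2] -/
def omegaAt {v : HeightOneSpectrum (𝓞 (Fp L))} {𝔪 : PlaceMeasure L v}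
    {ℓ : Submodule (v.adicCompletion (Fp L)) ((Fin (n + n) → v.adicCompletion (Fp L)) × (Fin (n + n) → v.adicCompletion (Fp L)))}
    {hℓ : LinearMap.BilinForm.orthogonal (alt (polar (localPairing (Fp L) (n + n) (gramD L e dV hdV dW hdW) v))) ℓ = ℓ}
    (𝓓 : LocalDatumAt L e dV hdV hdV0 dW hdW hdW0 v 𝔪 ℓ hℓ) :
    Representation ℂ (UnitaryGroup.localPi L (IsCMField.complexConj L) (n + n) (hermD L e dV hdV dW hdW) v)
      (SchwartzBruhat (Fin (n + n) → v.adicCompletion (Fp L))) := by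
  letI := 𝔪.mS; haveI := 𝔪.isBorel; haveI := 𝔪.isHaar
  exact LocalSplittingDatum.localOmega 𝓓

/-- the implementer `M_δ := r_v(δ)` of the datum (the section `r` at `deltaLoc v`).
[cite: GelbartRogawski1991, §3.1 Prop. 3.1.1 p. 455 L1–2] -/
def rDeltaAt {v : HeightOneSpectrum (𝓞 (Fp L))} {𝔪 : PlaceMeasure L v}
    {ℓ : Submodule (v.adicCompletion (Fp L)) ((Fin (n + n) → v.adicCompletion (Fp L)) × (Fin (n + n) → v.adicCompletion (Fp L)))}
    {hℓ : LinearMap.BilinForm.orthogonal (alt (polar (localPairing (Fp L) (n + n) (gramD L e dV hdV dW hdW) v))) ℓ = ℓ}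
    (𝓓 : LocalDatumAt L e dV hdV hdV0 dW hdW hdW0 v 𝔪 ℓ hℓ) :
    SchwartzBruhat (Fin (n + n) → v.adicCompletion (Fp L)) ≃ₗ[ℂ] SchwartzBruhat (Fin (n + n) → v.adicCompletion (Fp L)) := by
  letI := 𝔪.mS; haveI := 𝔪.isBorel; haveI := 𝔪.isHaar
  exact LocalSplittingDatum.r 𝓓 (deltaLoc L e dV hdV hdV0 dW hdW hdW0 v)

/-- **the PER-PLACE package** (built in `LocalDoubledUnitary*` from Kudla's local splitting): at every finite place a Lagrangian, a datum, the
parabolic normalisation (field `parabolicNormalised`) — and the unramified clause for almost all `v`; packaged as ONE family.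
[cite: GelbartRogawski1991, §3.1 Prop. 3.1.1 p. 455 L1–2] -/
structure FinLocalFamily (χ : HeckeCharacter L) (𝔪 : ∀ v, PlaceMeasure L v) where
  /-- the Lagrangian at `v` -/
  ℓ : ∀ v : HeightOneSpectrum (𝓞 (Fp L)),
    Submodule (v.adicCompletion (Fp L)) ((Fin (n + n) → v.adicCompletion (Fp L)) × (Fin (n + n) → v.adicCompletion (Fp L)))
  /-- each `ℓ v` is Lagrangian -/
  hℓ : ∀ v, LinearMap.BilinForm.orthogonal (alt (polar (localPairing (Fp L) (n + n) (gramD L e dV hdV dW hdW) v))) (ℓ v) = ℓ v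
  /-- the local splitting datum at `v` -/
  𝓓 : ∀ v, LocalDatumAt L e dV hdV hdV0 dW hdW hdW0 v (𝔪 v) (ℓ v) (hℓ v)
  /-- the local parabolic normalisation at every `v` -/
  parabolicNormalised : ∀ v, ParabolicNormalisedAt L e dV hdV dW hdW v χ
    (omegaAt L e dV hdV hdV0 dW hdW hdW0 (𝓓 v)) (rDeltaAt L e dV hdV hdV0 dW hdW hdW0 (𝓓 v))
  /-- the unramified clause, for almost all `v` -/
  unramified : ∀ᶠ v in Filter.cofinite,
    ∀ k ∈ UnitaryGroup.localInt L (IsCMField.complexConj L) (n + n) (hermD L e dV hdV dW hdW) v,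
      omegaAt L e dV hdV hdV0 dW hdW hdW0 (𝓓 v) k (unitVec (Fp L) (Fin (n + n)) v) = unitVec (Fp L) (Fin (n + n)) v


omit [IsCMField L] in
/-- Haar data exist at every place (Borel σ-algebra + Mathlib's `Measure.addHaar`).
[cite: GelbartRogawski1991, §3.1 Prop. 3.1.1 p. 455 L1–2] -/
theorem nonempty_placeMeasure (v : HeightOneSpectrum (𝓞 (Fp L))) : Nonempty (PlaceMeasure L v) := by
  letI : MeasurableSpace (v.adicCompletion (Fp L)) := borel _
  haveI : BorelSpace (v.adicCompletion (Fp L)) := ⟨rfl⟩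
  exact ⟨⟨_, inferInstance, MeasureTheory.Measure.addHaar, inferInstance⟩⟩

end PerPlace

/-! ## §5 `(π, ω)` are jointly injective on `Mp(𝕎^𝔻)ᶜᵒⁿᵗ`; archimedean and finite operators commute -/

/-- `π` and the operator map are jointly injective on `Mp(𝕎^𝔻)ᶜᵒⁿᵗ` (pairs).
[cite: GelbartRogawski1991, §3.1 Prop. 3.1.1 p. 455 L1–2] -/
theorem eq_of_proj_eq_of_op_eq (x y : MpD L e dV hdV dW hdW) (h1 : projD L e dV hdV dW hdW x = projD L e dV hdV dW hdW y)
    (h2 : ((x : adelicMp (Fp L) (Fin (n + n)) (gramDA L e dV hdV dW hdW)) :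
        symplecticGroup (polar (adelicForm (Fp L) (Fin (n + n)) (gramDA L e dV hdV dW hdW))) ×
          (piSchwartzBruhat (Fp L) (Fin (n + n)) ≃ₗ[ℂ] piSchwartzBruhat (Fp L) (Fin (n + n)))).2 =
      ((y : adelicMp (Fp L) (Fin (n + n)) (gramDA L e dV hdV dW hdW)) :
        symplecticGroup (polar (adelicForm (Fp L) (Fin (n + n)) (gramDA L e dV hdV dW hdW))) ×
          (piSchwartzBruhat (Fp L) (Fin (n + n)) ≃ₗ[ℂ] piSchwartzBruhat (Fp L) (Fin (n + n)))).2) : x = y :=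
  Subtype.ext (Subtype.ext (Prod.ext h1 h2))


/-- `ω(q)` as a linear map IS the operator component of the pair (definitional).
[cite: GelbartRogawski1991, §3.1 Prop. 3.1.1 p. 455 L1–2] -/
theorem omega_eq_toLinearMap (q : MpD L e dV hdV dW hdW) :
    adelicMpCont.omega (Fp L) (Fin (n + n)) (gramDA L e dV hdV dW hdW) q =
      (((q : adelicMp (Fp L) (Fin (n + n)) (gramDA L e dV hdV dW hdW)) :
        symplecticGroup (polar (adelicForm (Fp L) (Fin (n + n)) (gramDA L e dV hdV dW hdW))) ×
          (piSchwartzBruhat (Fp L) (Fin (n + n)) ≃ₗ[ℂ] piSchwartzBruhat (Fp L) (Fin (n + n)))).2 :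
        piSchwartzBruhat (Fp L) (Fin (n + n)) →ₗ[ℂ] piSchwartzBruhat (Fp L) (Fin (n + n))) := rfl

set_option maxHeartbeats 1600000 in
/-- `(π, ω)` are jointly injective on `Mp(𝕎^𝔻)ᶜᵒⁿᵗ`. [cite: GelbartRogawski1991, §3.1 Prop. 3.1.1 p. 455 L1–2] -/
theorem eq_of_proj_eq_of_omega_eq (x y : MpD L e dV hdV dW hdW) (h1 : projD L e dV hdV dW hdW x = projD L e dV hdV dW hdW y)
    (h2 : adelicMpCont.omega (Fp L) (Fin (n + n)) (gramDA L e dV hdV dW hdW) x =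
      adelicMpCont.omega (Fp L) (Fin (n + n)) (gramDA L e dV hdV dW hdW) y) : x = y := by
  refine eq_of_proj_eq_of_op_eq L e dV hdV dW hdW x y h1 (LinearEquiv.ext fun f => ?_)
  have h3 := LinearMap.congr_fun h2 f
  rw [adelicMpCont.omega_apply, omegaPsi_apply, adelicMpCont.omega_apply, omegaPsi_apply] at h3
  exact h3

omit [IsCMField L] in
/-- `A ⊗ 1` and `1 ⊗ B` commute on `𝒮(𝔸^{n+n})`. [cite: GelbartRogawski1991, §3.1 Prop. 3.1.1 p. 455 L1–2] -/
theorem adelicTensorEnd_left_right_comm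
    (A : SchwartzMap (Fin (n + n) → mixedEmbedding.mixedSpace (Fp L)) ℂ →ₗ[ℂ] SchwartzMap (Fin (n + n) → mixedEmbedding.mixedSpace (Fp L)) ℂ)
    (B : FinSB (Fp L) (Fin (n + n)) →ₗ[ℂ] FinSB (Fp L) (Fin (n + n))) :
    adelicTensorEnd A LinearMap.id * adelicTensorEnd LinearMap.id B = adelicTensorEnd LinearMap.id B * adelicTensorEnd A LinearMap.id := by
  rw [← adelicTensorEnd_mul, ← adelicTensorEnd_mul]
  simp only [Module.End.mul_eq_comp, LinearMap.id_comp, LinearMap.comp_id]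

/-! ### Build-lane note (ops-buildfix G11b-3 recipe, LEDGER B13-1, 2026-08-21)
`lean -o` (the hub build lane, never `lean`/the gate check) runs Lean 4.32's library-suggestion indexers
(`Lean.LibrarySuggestions.SymbolFrequency` / `SineQuaNon`, from their `exportEntriesFn`) over the statement of
every local theorem that is not a denied premise; on this family's statements (very large dependent binder
telescopes through the theta-kernel / dual-pair data) that fold runs for tens of minutes to hours and the build
lane kills the job (incident G11b-3, run/shared/lean/ops/buildfix/G11b-3-DOSSIER.md). `isDeniedPremise` skips
`[implicit_reducible]` constants before any fold, and a reducibility status on a *theorem* is inert (Meta never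
unfolds `thmInfo`; the kernel ignores the attribute), so the public theorems of this file are tagged
`[implicit_reducible]` purely to keep them out of that index. Only other effect: they are not offered by
`+suggestions` premise selectors. No statement or proof is changed; superseded if the operator lands a
deny-list form (`HarnessLib.PremiseIndex`). -/
set_option allowUnsafeReducibility true in
attribute [implicit_reducible]
  gramD_isSymm isUnit_det_gramD isUnit_det_gramDA adelicForm_hermD_eq
  reindex_deltaDiag_mem_symplecticGroup isUnit_det_gramDLoc nonempty_placeMeasure
  eq_of_proj_eq_of_op_eq omega_eq_toLinearMap eq_of_proj_eq_of_omega_eq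
  adelicTensorEnd_left_right_comm

end Literature.NumberTheory.GelbartRogawski1991.GRConstruction

/- build-lane note, addendum (ops-buildfix B14-5, 2026-08-22): local theorem constants the `[implicit_reducible]` block above
cannot reach — auto-realized `*.congr_simp` lemmas, structure projections / `mk.inj` / `sizeOf_spec` — are still walked by the
`.olean` exporter's premise indexers (in-file census: FOLDED = 23, proxy 2.0e+11). A global `attribute` on a realized constant lands
on an async environment branch the exporter does not consult; this file-final, top-level `local` entry goes through the
synchronous scoped extension that `getReducibilityStatusCore` reads first and is never popped before export. It is not
exported and changes no statement or proof. -/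
set_option allowUnsafeReducibility true in
attribute [local implicit_reducible]
  Literature.NumberTheory.GelbartRogawski1991.GRConstruction.IsArchHalf.parabolic
  Literature.NumberTheory.GelbartRogawski1991.GRConstruction.IsFinHalf.parabolic
  Literature.NumberTheory.GelbartRogawski1991.GRConstruction.IsArchHalf.proj_eq
  Literature.NumberTheory.GelbartRogawski1991.GRConstruction.IsFinHalf.proj_eq
  Literature.NumberTheory.GelbartRogawski1991.GRConstruction.IsDoubledWeilRep.proj_eq
  Literature.NumberTheory.GelbartRogawski1991.GRConstruction.IsDoubledWeilRep.parabolic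
  Literature.NumberTheory.GelbartRogawski1991.GRConstruction.IsArchHalf.isArch
  Literature.NumberTheory.GelbartRogawski1991.GRConstruction.IsFinHalf.isFinite
  Literature.NumberTheory.GelbartRogawski1991.GRConstruction.IsArchHalf.continuous
  Literature.NumberTheory.GelbartRogawski1991.GRConstruction.IsFinHalf.continuous
  Literature.NumberTheory.GelbartRogawski1991.GRConstruction.IsDoubledWeilRep.continuous
  Literature.NumberTheory.GelbartRogawski1991.GRConstruction.FinLocalFamily.mk.injEq
  Literature.NumberTheory.GelbartRogawski1991.GRConstruction.FinLocalFamily.mk.inj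
  Literature.NumberTheory.GelbartRogawski1991.GRConstruction.FinLocalFamily.mk.sizeOf_spec
  Literature.NumberTheory.GelbartRogawski1991.GRConstruction.FinLocalFamily.parabolicNormalised
  Literature.NumberTheory.GelbartRogawski1991.GRConstruction.FinLocalFamily.unramified
  Literature.NumberTheory.GelbartRogawski1991.GRConstruction.FinLocalFamily.hℓ
  Literature.NumberTheory.GelbartRogawski1991.GRConstruction.PlaceMeasure.mk.injEq
  Literature.NumberTheory.GelbartRogawski1991.GRConstruction.PlaceMeasure.mk.inj
  Literature.NumberTheory.GelbartRogawski1991.GRConstruction.PlaceMeasure.mk.sizeOf_spec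
  Literature.NumberTheory.GelbartRogawski1991.UnitaryDualPair.realDiagonal.congr_simp
  Literature.NumberTheory.GelbartRogawski1991.GRConstruction.PlaceMeasure.isHaar
  Literature.NumberTheory.GelbartRogawski1991.GRConstruction.PlaceMeasure.isBorel
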